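import Literature.NumberTheory.PAdicHodge.BdRPlusFormalLogAdd
import Literature.NumberTheory.PAdicHodge.BdRPlusFormalLogXiAdic
import HarnessLib

/-!
# `(σ − 1) · log_W(ι[ũ]) ≡ ∫_{κ_u(σ)} ω (mod Fil^k B_dR⁺)`: Fontaine's integrating element of the Kummer cocycle of a point of `Ŵ`

Topic `Literature/NumberTheory/PAdicHodge`; namespace `Literature.NumberTheory.PAdicHodge.GaloisContinuity`. THEOREMS ONLY (no definition, no instance, no
named fact, no `sorry`). Assembly of K1 (`AinfWeierstrassDivisionLift`: Fontaine's integral `[ũ] ∈ Ŵ(𝔫)` of a `[p]`-division sequence `u` of a point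
`P = u₀` of `Ŵ(𝔪_{ℂ_F})`, with `σ[ũ] − [ũ] = [κ_u(σ)]` in the GROUP `Ŵ(𝔫)`) with this seat's `p`-adic formal logarithm modulo `Fil^k`
(`BdRPlusFormalLogModFil`, `BdRPlusFormalLogAdd`: additivity along `⊕_W`; `BdRPlusFormalLogXiAdic`: `∫_t ω` is a value on torsion):

* ★★ `IsFormalLogModFil.galBdRPlus_sub_sub_omegaPeriod_mem` — if `[ũ]` has its coordinate in `(p, ξ)` (e.g. `P ∈ Ŵ(p𝒪)`), `L` is a value of
  `log_W(ι[ũ])` modulo `Fil^k`, and `σ ∈ Γ_F` fixes `u₀`, then **`σ L − L − ∫_{κ_u(σ)} ω ∈ ξ^k B_dR⁺`** — the elliptic twin of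
  `BdRPlusTop.gal_kummerUnitLog_eq` (`(σ−1)ℓ_u = κ_u(σ)·t`, Bloch–Kato Ex. 3.10.1) WITHOUT the `Γ_F`-fixed correcting lift `Q` of K1: the integrating element is
  Fontaine's own `log_W(ι[ũ])`, whose `θ`-value is `log_ω(P)` (`IsFormalLogModFil.thetaBdR_eq_of_tendsto`) — the quantity of Kato's explicit reciprocity law.

Floor (H4) step (3) of `Summits/…/Cruxes/StarredOptimalManinUnitFiveSeven/Lines/kato-lever-K3-B2-road.md` (memo `…-K3-H4-log.md` §3b; crux K★
`stmt-BirchSwinnertonDyer-22226`). Infrastructure only; BSD / K★ are not proved by any of this.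

## References
* S. Bloch, K. Kato, *L-functions and Tamagawa numbers of motives* (1990), Ex. 3.10.1, (3.11). [BlochKato1990]
* J.-M. Fontaine, *Formes différentielles et modules de Tate…*, Invent. Math. 65 (1982), §5. [Fontaine1982FormesDifferentielles]
* K. Kato, LNM 1553 (1993), Ch. II Lemma 1.4.3. [Kato1993LNM1553]
-/

noncomputable section

namespace Literature.NumberTheory.PAdicHodge

namespace GaloisContinuity

open ValuativeRel Field Ideal WittVector
open Literature.NumberTheory.GaloisRepresentations Literature.NumberTheory.GaloisRepresentations.IsNonarchimedeanLocalField
open Literature.NumberTheory.GaloisRepresentations.LubinTate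

variable {F : Type} [Field F] [ValuativeRel F] [TopologicalSpace F] [IsNonarchimedeanLocalField F]
  [CharZero F] {p : ℕ} [Fact p.Prime] [Fact (¬ IsUnit (p : integerC F))]
  [IsAdicComplete (Ideal.span {(p : integerC F)}) (integerC F)]
  {hθ : Function.Surjective (fontaineTheta (integerC F) p)}

/-- **Values on equal points of `Ŵ(𝔫)` agree**: `IsFormalLogModFil` only depends on the coordinate. [cite: Fontaine1982FormesDifferentielles, §5] -/
theorem IsFormalLogModFil.of_pt_eq {W : WeierstrassCurve ℤ} {k : ℕ} {P Q : W.Pt (AinfTop.nilTheta F p hθ)} (h : P = Q)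
    {L : BDeRhamPlus (integerC F) p} (hL : IsFormalLogModFil W k ((AinfTop.of F p).symm (P.val : AinfTop F p)) L) :
    IsFormalLogModFil W k ((AinfTop.of F p).symm (Q.val : AinfTop F p)) L := by
  subst h; exact hL

/-- ★★ **`σ(log_W(ι[ũ])) − log_W(ι[ũ]) ≡ ∫_{κ_u(σ)} ω (mod Fil^k)`.** Let `u` be a `[p]`-division sequence of points of `Ŵ(𝔪_{ℂ_F})` whose Fontaine integral
`[ũ] ∈ Ŵ(𝔫)` (K1 `AinfTop.divisionLiftPt`) has its coordinate in `(p, ξ)𝔸_inf`, let `σ ∈ Γ_F` fix `u₀`, and let `L` be a value of `log_W(ι[ũ])` modulo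
`Fil^k`. Then `σ L − L − ∫_{κ_u(σ)} ω ∈ ξ^k B_dR⁺`, where `∫_{κ_u(σ)} ω = AinfTop.omegaPeriod` of the Kummer torsion sequence `κ_u(σ) = kummerSeq σ u`
(`σ[ũ] = [ũ] ⊕ [κ_u(σ)]` in `Ŵ(𝔫)`, additivity and `ξ`-adic compatibility of `log_W mod Fil^k`, uniqueness).
[cite: BlochKato1990, Ex. 3.10.1] [cite: Fontaine1982FormesDifferentielles, §5] [cite: Kato1993LNM1553, Ch. II Lemma 1.4.3] -/
theorem IsFormalLogModFil.galBdRPlus_sub_sub_omegaPeriod_mem (W : WeierstrassCurve ℤ) {k : ℕ} {u : ℕ → (maxNilIdealC F).toIdeal}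
    (hup : ∀ n, AinfTop.mulPC F p W (u (n + 1)) = u n) (σ : absoluteGaloisGroup F) (hu₀ : galCBall σ (u 0 : CBall F) = u 0)
    (hI : (AinfTop.of F p).symm (AinfTop.torsionLift W hθ u hup) ∈ Ideal.span {(p : Ainf (p := p) F), xi})
    {L : BDeRhamPlus (integerC F) p} (hL : IsFormalLogModFil W k ((AinfTop.of F p).symm (AinfTop.torsionLift W hθ u hup)) L) :
    PAdicHodge.galBdRPlus σ L - L - (BdRPlusTop.of F p).symm (AinfTop.omegaPeriod W hθ (AinfTop.kummerSeq W σ u)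
      (AinfTop.coe_kummerSeq_zero W σ hu₀) (AinfTop.mulPC_kummerSeq W σ hup)) ∈
      Ideal.span {(xiBdR : BDeRhamPlus (integerC F) p) ^ k} := by
  set P : W.Pt (AinfTop.nilTheta F p hθ) := AinfTop.divisionLiftPt W hθ u hup with hP
  set K : W.Pt (AinfTop.nilTheta F p hθ) := AinfTop.divisionLiftPt W hθ (AinfTop.kummerSeq W σ u) (AinfTop.mulPC_kummerSeq W σ hup) with hK
  set Ω : BDeRhamPlus (integerC F) p := (BdRPlusTop.of F p).symm (AinfTop.omegaPeriod W hθ (AinfTop.kummerSeq W σ u)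
      (AinfTop.coe_kummerSeq_zero W σ hu₀) (AinfTop.mulPC_kummerSeq W σ hup)) with hΩ
  -- coordinates
  have hPval : (AinfTop.of F p).symm (P.val : AinfTop F p) = (AinfTop.of F p).symm (AinfTop.torsionLift W hθ u hup) := rfl
  have hKI : (AinfTop.of F p).symm (K.val : AinfTop F p) ∈ Ideal.span {(p : Ainf (p := p) F), xi} :=
    Ideal.span_mono (Set.subset_insert _ _)
      (AinfTop.torsionLift_mem_span_xi W (hθ := hθ) (AinfTop.coe_kummerSeq_zero W σ hu₀) (AinfTop.mulPC_kummerSeq W σ hup))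
  -- `Ω` is a value at `K`, `L + Ω` a value at `P + K`, `σ L` a value at `σ P`, and `σ P = P + K`
  have hΩ' : IsFormalLogModFil W k ((AinfTop.of F p).symm (K.val : AinfTop F p)) Ω :=
    isFormalLogModFil_omegaPeriod W k (AinfTop.coe_kummerSeq_zero W σ hu₀) (AinfTop.mulPC_kummerSeq W σ hup)
  have hsum : IsFormalLogModFil W k ((AinfTop.of F p).symm ((P + K).val : AinfTop F p)) (L + Ω) := by
    rw [AinfTop.val_add_N]
    exact IsFormalLogModFil.addW W (by rw [hPval]; exact hI) hKI (by rw [hPval]; exact hL) hΩ'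
  have hgal : IsFormalLogModFil W k ((AinfTop.of F p).symm ((AinfTop.galPtN W hθ σ P).val : AinfTop F p)) (PAdicHodge.galBdRPlus σ L) := by
    rw [AinfTop.coe_val_galPtN]
    exact hL.galBdRPlus σ
  have hPK : AinfTop.galPtN W hθ σ P = P + K := by
    rw [hK, AinfTop.divisionLiftPt_kummerSeq W σ hup, ← hP]; abel
  have h := (hgal.of_pt_eq hPK).sub_mem_span_xiBdR_pow hsum
  rwa [show PAdicHodge.galBdRPlus σ L - (L + Ω) = PAdicHodge.galBdRPlus σ L - L - Ω by ring] at h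

end GaloisContinuity

end Literature.NumberTheory.PAdicHodge

end
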